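import Summits.MatrixMultiplication.MatrixMultiplication.Theorems.EdgePencilFatEnd
import Literature.Computability.AlgebraicComplexity.RectangularExponentSubadditivity
import HarnessLib

/-!
# The fat end of the sixth-edge ladder is flat: `k + 3 ≤ ω_fat(k) ≤ ω(1,a,1) + ω(1,k−a,1) + 1`

Support kernel for `stmt-MatrixMultiplication-26697` (`TetraExcessZero : ω(K₄) ≤ ω(2,1,2)`, the
attacked leaf of route `TetrahedronCarving`; lineage `decomp-mm-lens-6` «barrier-complement carving»,
generation 26, memo NODE-g26 §2 I-R3). No item is added or changed. Exponent layer of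
`EdgePencilFatEnd` (the fat tetrahedron `fatTetra F B N`, its grouping floor and its re-routing cover).

THE OBJECT. `ω_fat(k) = omegaFat F k` is the exponent of the fat family `n ↦ fatTetra F (n^k) n` — the
tetrahedron graph tensor with bond `n^k` on the pendant edge `01` and bond `n` on the other five edges:
the lineage's sixth-edge ladder `χ(δ)` (`EdgePencilSixthLadder`, `0 ≤ δ ≤ 1`) EXTENDED to the integer
pendant exponents `δ = k ≥ 1`, with `ω_fat(1) = ω(K₄)` (`omegaFat_one`).

THE RESULTS (every field).
* GROUPING FLOOR `ω(k+1, 1, 2) ≤ ω_fat(k)`, hence the flattening floor `k + 3 ≤ ω_fat(k)` (`k ≥ 1`).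
* RE-ROUTING COVER `ω_fat(a+b) ≤ ω(1,a,1) + ω(1,b,1) + 1`: two rectangular triangles `012`, `013`
  THROUGH the pendant (shares `n^a`, `n^b` of its bond `n^{a+b}`) times the bare edge `23`; hence the
  unconditional bracket `k + 3 ≤ ω_fat(k) ≤ 2ω + (k − 1)` for `k ≥ 2` (`omegaFat_le_two_omega_add`,
  `omegaFat_two_le`), and AT `ω = 2` EXACTLY MAX-CUT: `ω_fat(k) = k + 3` for every `k ≥ 2`
  (`omegaFat_eq_of_omega_eq_two`; memo I-R3 (b) `ω = 2 ⟹ χ_ext = max(4, 3+δ)` at the integer points).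
* FAT-END FLATNESS (`omegaFat_fatEnd_flat`): IF `ω(1,k,1) ≤ k + 1 + ε` for all large `k` — the
  Lotti–Romani theorem, Prop. 4.1: `inf_x (ω(1,x,1) − x) = 1` (indeed `ω(1,k,1) = k + 1 + O(1/log k)`, a
  consequence of Schönhage's identity; see also arXiv:2604.01386 §8, p. 49), carried here as a
  HYPOTHESIS (real `k₀`, real `k`) because it is not yet a Literature fact of the tree — THEN `k + 3 ≤ ω_fat(k) ≤ k + 3 + ε` for all large `k`: the far end of the extended
  ladder is flattening-tight, by the very re-routing that realises pendant absorption at `ω = 2`.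
  Reading for the leaf (memo I-R3): «flattening-tight ⟺ the mirror pairing saves `min(δ,1)`» is a
  theorem at `δ → ∞`, the prediction of `ω = 2` on `[0,1]`, and the rung `stub_sixRungPos` at `δ → 0⁺`.

References: Christandl–Vrana–Zuiddam, arXiv:1609.07476, Def. 1.1.13/1.1.25, Prop. 1.1.26
[ChristandlVranaZuiddam2016]; Lotti–Romani 1983, Prop. 4.1, §1–§2 [LottiRomani1983]; Bläser 2013, Lemma 7.1
(flattening lower bound) [Blaser2013]. No `sorry`, no new axiom, no instance, no notation.
-/

noncomputable section

set_option linter.dupNamespace false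

open scoped BigOperators
open Filter Asymptotics Finset
open Literature.Computability.AlgebraicComplexity
open Summit.MatrixMultiplication.MatrixMultiplication.Theorems.TetrahedronTensor
open Summit.MatrixMultiplication.MatrixMultiplication.Theorems.TetraDiagonal

namespace Summit.MatrixMultiplication.MatrixMultiplication.Theorems.EdgePencil

/-! ## §4 The fat exponents `ω_fat(k)`: floor, cover, and the flat fat end -/

section Exponent

variable (F : Type) [Field F]

/-- Admissible exponents of the fat family `n ↦ fatTetra F (n^k) n` (pendant bond `n^k`, the other five
edges of bond `n`). (CVZ19 Def. 1.1.13, non-uniform dimensions as in Ex. 1.1.2). -/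
def fatAdmissibleExponents (k : ℕ) : Set ℝ :=
  {β : ℝ | (fun n : ℕ => (tensorRankD (fatTetra F (n ^ k) n) : ℝ)) =O[atTop] fun n : ℕ => (n : ℝ) ^ β}

/-- **The fat exponent** `ω_fat(k) = inf {β | R₄(fatTetra F (n^k) n) = O(n^β)}` — the sixth-edge ladder
`χ` extended to the integer pendant exponents `δ = k ≥ 1`; `ω_fat(1) = ω(K₄)`. (CVZ19 Def. 1.1.25). -/
def omegaFat (k : ℕ) : ℝ :=
  sInf (fatAdmissibleExponents F k)

/-- At `k = 1` the fat family is the tetrahedron family `T(K₄)_n`. -/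
theorem fatAdmissibleExponents_one : fatAdmissibleExponents F 1 = tetraAdmissibleExponents F := by
  have hf : (fun n : ℕ => (tensorRankD (fatTetra F (n ^ 1) n) : ℝ)) =
      fun n : ℕ => (tensorRankD (tetra F n) : ℝ) := by
    funext n
    rw [pow_one, fatTetra_self]
  ext β
  simp only [fatAdmissibleExponents, tetraAdmissibleExponents, Set.mem_setOf_eq]
  rw [hf]

/-- **`ω_fat(1) = ω(K₄)`**: the extended ladder starts at the tetrahedron exponent. -/
theorem omegaFat_one : omegaFat F 1 = omegaTetra F := by
  unfold omegaFat omegaTetra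
  rw [fatAdmissibleExponents_one]

/-- `6k` is admissible for the fat family (restriction of `T(K₄)` at level `n^k`). -/
theorem six_mul_mem_fatAdmissibleExponents (k : ℕ) : (6 * k : ℝ) ∈ fatAdmissibleExponents F k := by
  refine IsBigO.of_bound 1 (Eventually.of_forall fun n => ?_)
  rw [one_mul, Real.norm_of_nonneg (Nat.cast_nonneg _),
    Real.norm_of_nonneg (Real.rpow_nonneg (Nat.cast_nonneg _) _)]
  have h := (tensorRankD_fatTetra_le_tetra (F := F) (n ^ k) n).trans
    (tensorRankD_tetra_le (F := F) (n ^ k))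
  calc (tensorRankD (fatTetra F (n ^ k) n) : ℝ) ≤ ((n ^ k) ^ 6 : ℕ) := by exact_mod_cast h
    _ = (n : ℝ) ^ (6 * k : ℝ) := by
      rw [show (6 * k : ℝ) = ((k * 6 : ℕ) : ℝ) by push_cast; ring, Real.rpow_natCast, pow_mul]
      norm_cast

/-- The admissible exponents of the fat family are nonempty. -/
theorem fatAdmissibleExponents_nonempty (k : ℕ) : (fatAdmissibleExponents F k).Nonempty :=
  ⟨6 * k, six_mul_mem_fatAdmissibleExponents F k⟩

/-- Grouping: admissible for the fat family (`k ≥ 1`) ⟹ admissible for `⟨n^{k+1}, n, n²⟩`. [folklore] -/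
theorem fatAdmissibleExponents_subset_rect {k : ℕ} (hk : 1 ≤ k) :
    fatAdmissibleExponents F k ⊆ rectAdmissibleExponents F ((k : ℝ) + 1) 1 2 := by
  intro β hβ
  refine IsBigO.trans ?_ hβ
  refine IsBigO.of_bound 1 ?_
  filter_upwards [eventually_ge_atTop 1] with n hn
  rw [one_mul, Real.norm_of_nonneg (Nat.cast_nonneg _), Real.norm_of_nonneg (Nat.cast_nonneg _)]
  haveI : NeZero n := ⟨by omega⟩
  have h1 : rectDim n ((k : ℝ) + 1) = n ^ k * n := by
    rw [show ((k : ℝ) + 1) = ((k + 1 : ℕ) : ℝ) by push_cast; ring, rectDim_natCast, pow_succ]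
  have h2 : rectDim n 2 = n * n := by
    rw [show (2 : ℝ) = ((2 : ℕ) : ℝ) by norm_num, rectDim_natCast, pow_two]
  rw [tensorRank_matMulTensor_congr F h1 (rectDim_one n) h2]
  have hNB : n ≤ n ^ k := Nat.le_self_pow (by omega) n
  exact_mod_cast tensorRank_matMulTensor_le_tensorRankD_fatTetra (F := F) hNB

/-- The admissible exponents of the fat family (`k ≥ 1`) are bounded below (grouping). -/
theorem fatAdmissibleExponents_bddBelow {k : ℕ} (hk : 1 ≤ k) : BddBelow (fatAdmissibleExponents F k) :=
  (rectAdmissibleExponents_bddBelow F _ 1 2).mono (fatAdmissibleExponents_subset_rect F hk)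

/-- **Grouping floor in exponents** `ω(k+1, 1, 2) ≤ ω_fat(k)` (`k ≥ 1`). [folklore] -/
theorem omegaRect_le_omegaFat {k : ℕ} (hk : 1 ≤ k) : omegaRect F ((k : ℝ) + 1) 1 2 ≤ omegaFat F k :=
  csInf_le_csInf (rectAdmissibleExponents_bddBelow F _ 1 2) (fatAdmissibleExponents_nonempty F k)
    (fatAdmissibleExponents_subset_rect F hk)

/-- **Flattening floor in exponents** `k + 3 ≤ ω_fat(k)` (`k ≥ 1`; information bound
`(k+1) + 2 ≤ ω(k+1, 1, 2)`). [folklore] -/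
theorem add_three_le_omegaFat {k : ℕ} (hk : 1 ≤ k) : (k : ℝ) + 3 ≤ omegaFat F k := by
  have h := add_le_omegaRect₁₃ F ((k : ℝ) + 1) 1 2
  have h' := omegaRect_le_omegaFat F hk
  linarith

/-- **The cover in admissible exponents**: `β₁` admissible for `(a,1,1)` and `β₂` for `(b,1,1)` ⟹
`β₁ + β₂ + 1` admissible for the fat family at `k = a + b` (the finite cover of §3 at
`B₁ = n^a, B₂ = n^b, N = n`). [cite: ChristandlVranaZuiddam2016, Prop. 1.1.26] -/
theorem mem_fatAdmissibleExponents_of_cover {a b : ℕ} {β₁ β₂ : ℝ}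
    (h₁ : β₁ ∈ rectAdmissibleExponents F a 1 1) (h₂ : β₂ ∈ rectAdmissibleExponents F b 1 1) :
    β₁ + β₂ + 1 ∈ fatAdmissibleExponents F (a + b) := by
  obtain ⟨C₁, hC₁0, hC₁⟩ := bound_of_isBigO_nat_atTop h₁
  obtain ⟨C₂, hC₂0, hC₂⟩ := bound_of_isBigO_nat_atTop h₂
  refine IsBigO.of_bound (C₁ * C₂) ?_
  filter_upwards [eventually_ge_atTop 1] with n hn
  have hn0 : (0 : ℝ) < n := by exact_mod_cast hn
  have hR₁ : (tensorRank (matMulTensor F (n ^ a) n n) : ℝ) ≤ C₁ * (n : ℝ) ^ β₁ := by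
    have h := hC₁ (Real.rpow_pos_of_pos hn0 β₁).ne'
    rwa [Real.norm_of_nonneg (Nat.cast_nonneg _), Real.norm_of_nonneg (Real.rpow_nonneg hn0.le _),
      tensorRank_matMulTensor_congr F (rectDim_natCast n a) (rectDim_one n) (rectDim_one n)] at h
  have hR₂ : (tensorRank (matMulTensor F (n ^ b) n n) : ℝ) ≤ C₂ * (n : ℝ) ^ β₂ := by
    have h := hC₂ (Real.rpow_pos_of_pos hn0 β₂).ne'
    rwa [Real.norm_of_nonneg (Nat.cast_nonneg _), Real.norm_of_nonneg (Real.rpow_nonneg hn0.le _),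
      tensorRank_matMulTensor_congr F (rectDim_natCast n b) (rectDim_one n) (rectDim_one n)] at h
  rw [Real.norm_of_nonneg (Nat.cast_nonneg _), Real.norm_of_nonneg (Real.rpow_nonneg hn0.le _),
    Real.rpow_add hn0, Real.rpow_add hn0, Real.rpow_one]
  have hfin : tensorRankD (fatTetra F (n ^ (a + b)) n) ≤
      tensorRank (matMulTensor F (n ^ a) n n) * tensorRank (matMulTensor F (n ^ b) n n) * n := by
    rw [pow_add]
    exact tensorRankD_fatTetra_le_cover (F := F) (n ^ a) (n ^ b) n
  calc (tensorRankD (fatTetra F (n ^ (a + b)) n) : ℝ)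
      ≤ (tensorRank (matMulTensor F (n ^ a) n n) : ℝ) *
          (tensorRank (matMulTensor F (n ^ b) n n) : ℝ) * n := by exact_mod_cast hfin
    _ ≤ C₁ * (n : ℝ) ^ β₁ * (C₂ * (n : ℝ) ^ β₂) * n :=
        mul_le_mul_of_nonneg_right (mul_le_mul hR₁ hR₂ (by positivity) (by positivity))
          (by positivity)
    _ = C₁ * C₂ * ((n : ℝ) ^ β₁ * (n : ℝ) ^ β₂ * (n : ℝ)) := by ring

/-- **The re-routing cover in exponents** `ω_fat(a+b) ≤ ω(1,a,1) + ω(1,b,1) + 1` (`a + b ≥ 1`): two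
rectangular triangles through the pendant and the bare edge `23`. [cite: ChristandlVranaZuiddam2016, Prop. 1.1.26] -/
theorem omegaFat_le_cover {a b : ℕ} (hab : 1 ≤ a + b) :
    omegaFat F (a + b) ≤ omegaRect F 1 a 1 + omegaRect F 1 b 1 + 1 := by
  rw [omegaRect_swap₁₂ F 1 a 1, omegaRect_swap₁₂ F 1 b 1]
  have h : ∀ β₁ ∈ rectAdmissibleExponents F a 1 1, ∀ β₂ ∈ rectAdmissibleExponents F b 1 1,
      omegaFat F (a + b) ≤ β₁ + β₂ + 1 := fun β₁ hβ₁ β₂ hβ₂ =>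
    csInf_le (fatAdmissibleExponents_bddBelow F hab) (mem_fatAdmissibleExponents_of_cover F hβ₁ hβ₂)
  have hb : ∀ β₁ ∈ rectAdmissibleExponents F a 1 1,
      omegaFat F (a + b) - β₁ - 1 ≤ omegaRect F b 1 1 := fun β₁ hβ₁ => by
    have h3 := le_csInf (rectAdmissibleExponents_nonempty F b 1 1)
      (fun β₂ hβ₂ => show omegaFat F (a + b) - β₁ - 1 ≤ β₂ by have := h β₁ hβ₁ β₂ hβ₂; linarith)
    exact h3
  have ha : omegaFat F (a + b) - omegaRect F b 1 1 - 1 ≤ omegaRect F a 1 1 :=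
    le_csInf (rectAdmissibleExponents_nonempty F a 1 1)
      (fun β₁ hβ₁ => by have := hb β₁ hβ₁; linarith)
  linarith

/-- **The fat end of the ladder is flat** (conditional form). HYPOTHESIS `hLR` = Lotti–Romani 1983,
Prop. 4.1: `inf_x (ω(1,x,1) − x) = 1`, in the eventual form `ω(1, k, 1) ≤ k + 1 + ε` for all large real
`k` (the infimum is a limit because `x ↦ ω(1,x,1) − x` is non-increasing, §2 p. 174; indeed
`ω(1,k,1) = k + 1 + O(1/log k)`), carried as a hypothesis because it is not yet a Literature fact of the
tree (cite request wi-100822). CONCLUSION: `ω_fat(k) ≤ k + 3 + ε` for all large `k` (cover at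
`a = ⌊k/2⌋`, `b = ⌈k/2⌉`, both `→ ∞`) — with the floor `k + 3 ≤ ω_fat(k)`, the extended ladder is
flattening-tight at its far end, by the re-routing cover (pendant absorption). [cite: LottiRomani1983, Prop. 4.1 (pp. 180–181) and §2 (p. 174)] -/
theorem omegaFat_le_of_lottiRomani
    (hLR : ∀ ε : ℝ, 0 < ε → ∃ k₀ : ℝ, ∀ k : ℝ, k₀ ≤ k → omegaRect F 1 k 1 ≤ k + 1 + ε) :
    ∀ ε : ℝ, 0 < ε → ∃ k₀ : ℕ, ∀ k : ℕ, k₀ ≤ k → omegaFat F k ≤ k + 3 + ε := by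
  intro ε hε
  obtain ⟨k₀, hk₀⟩ := hLR (ε / 2) (by linarith)
  refine ⟨2 * ⌈k₀⌉₊ + 2, fun k hk => ?_⟩
  have hsplit : k / 2 + (k - k / 2) = k := by omega
  have ha : ⌈k₀⌉₊ ≤ k / 2 := by omega
  have hb : ⌈k₀⌉₊ ≤ k - k / 2 := by omega
  have h1 := hk₀ ((k / 2 : ℕ) : ℝ) ((Nat.le_ceil k₀).trans (by exact_mod_cast ha))
  have h2 := hk₀ ((k - k / 2 : ℕ) : ℝ) ((Nat.le_ceil k₀).trans (by exact_mod_cast hb))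
  have hcov := omegaFat_le_cover F (a := k / 2) (b := k - k / 2) (by omega)
  rw [hsplit] at hcov
  have hcast : ((k / 2 : ℕ) : ℝ) + ((k - k / 2 : ℕ) : ℝ) = k := by exact_mod_cast hsplit
  linarith

/-- **Fat-end bracket** (conditional on Lotti–Romani): `k + 3 ≤ ω_fat(k) ≤ k + 3 + ε` for all large `k`.
[cite: LottiRomani1983, Prop. 4.1 (pp. 180–181) and §2 (p. 174)] -/
theorem omegaFat_fatEnd_flat
    (hLR : ∀ ε : ℝ, 0 < ε → ∃ k₀ : ℝ, ∀ k : ℝ, k₀ ≤ k → omegaRect F 1 k 1 ≤ k + 1 + ε) :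
    ∀ ε : ℝ, 0 < ε → ∃ k₀ : ℕ, ∀ k : ℕ, k₀ ≤ k →
      (k : ℝ) + 3 ≤ omegaFat F k ∧ omegaFat F k ≤ k + 3 + ε := by
  intro ε hε
  obtain ⟨k₀, hk₀⟩ := omegaFat_le_of_lottiRomani F hLR ε hε
  refine ⟨k₀ + 1, fun k hk => ⟨add_three_le_omegaFat F (by omega), hk₀ k (by omega)⟩⟩

/-- **Unconditional instance of the cover** `ω_fat(k) ≤ 2ω + (k − 1)` (`k ≥ 2`; `a = 1`, `b = k − 1`,
`ω(1,1,1) = ω` and the padding bound `ω(1, k−1, 1) ≤ ω + (k − 2)`), against the floor `k + 3 ≤ ω_fat(k)`.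
[cite: ChristandlVranaZuiddam2016, Prop. 1.1.26] [cite: LottiRomani1983, §1 (p. 173)] -/
theorem omegaFat_le_two_omega_add {k : ℕ} (hk : 2 ≤ k) : omegaFat F k ≤ 2 * omega F + ((k : ℝ) - 1) := by
  have hk' : (2 : ℝ) ≤ k := by exact_mod_cast hk
  have hcov := omegaFat_le_cover F (a := 1) (b := k - 1) (by omega)
  have hk1 : 1 + (k - 1) = k := by omega
  rw [hk1, Nat.cast_one, omegaRect_one_one_one] at hcov
  have hc : ((k - 1 : ℕ) : ℝ) = (k : ℝ) - 1 := by rw [Nat.cast_sub (by omega), Nat.cast_one]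
  rw [hc] at hcov
  have hpad := omegaRect_add_le_add_pos F 1 1 1 0 ((k : ℝ) - 1 - 1) 0
  rw [add_zero, add_sub_cancel, max_self, max_eq_left (by linarith : (0 : ℝ) ≤ (k : ℝ) - 1 - 1),
    zero_add, add_zero, omegaRect_one_one_one] at hpad
  linarith

/-- `ω_fat(2) ≤ 2ω + 1` against the floor `5 ≤ ω_fat(2)`. [cite: ChristandlVranaZuiddam2016, Prop. 1.1.26] -/
theorem omegaFat_two_le : omegaFat F 2 ≤ 2 * omega F + 1 := by
  have h := omegaFat_le_two_omega_add F (k := 2) le_rfl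
  norm_num at h
  linarith

/-- **At `ω = 2` the extended ladder is exactly max-cut at every integer `k ≥ 2`: `ω_fat(k) = k + 3`**
(memo I-R3 (b): `ω = 2 ⟹ χ_ext = max(4, 3 + δ)`, integer points `δ ≥ 2`; `δ = 1` is `ω(K₄) = 4`, the
tree's `2ω` bound). [cite: ChristandlVranaZuiddam2016, Prop. 1.1.26] -/
theorem omegaFat_eq_of_omega_eq_two (hω : omega F = 2) {k : ℕ} (hk : 2 ≤ k) :
    omegaFat F k = (k : ℝ) + 3 := by
  refine le_antisymm ?_ (add_three_le_omegaFat F (by omega))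
  have h := omegaFat_le_two_omega_add F hk
  rw [hω] at h
  linarith

end Exponent

end Summit.MatrixMultiplication.MatrixMultiplication.Theorems.EdgePencil

end
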